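import Mathlib.Analysis.Complex.Norm
import Mathlib.Tactic.IntervalCases
import Mathlib.Tactic.Linarith
import Mathlib.Tactic.Ring
import Literature.Probability.Percolation.SiteEmbDomainCrossing
import HarnessLib

/-!
# The metric description of Beffara's centred square lattice `G_s` (stub `stub_gsDictionary`)

Helper file for the crux `Target` (stmt-CriticalPhenomena-6431) of route `CardyFlipRusso`
(sub-problem `CardyFormulaZ2`), line `Sketch`: the registered stub `stub_gsDictionary`.

Beffara's centred square lattice `G_s` (V. Beffara, *Is critical 2D percolation universal?*
(2008), §5.1) is `ℤ² ∪ (ℤ² + (½, ½))`: the square lattice with one extra vertex at the centre of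
each face, joined to the four corners of that face.  The tree defines it COMBINATORIALLY as
`Literature.Probability.Percolation.centredSquareGraph` on the vertex type `(ℤ × ℤ) ⊕ (ℤ × ℤ)`
(`Sum.inl x` the site `x`, `Sum.inr (k, l)` the centre of the face with lower-left corner `(k, l)`),
together with the standard embedding `centredSquareEmbedding` (`Sum.inl (a, b) ↦ a + b i`,
`Sum.inr (k, l) ↦ (k + ½) + (l + ½) i`).  The crux `Target` of route `CardyFlipRusso` describes
the SAME graph METRICALLY through that embedding: `a — b` iff `a` is a site and either `b` is a
site at distance exactly `1`, or `b` is a face centre at distance `< 1` (symmetrised by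
`SimpleGraph.fromRel`).  This file proves that the two descriptions agree
(`stub_gsDictionary`), the alignment the tree file `SiteEmbDomainCrossing.lean` leaves "to the
planners".

The computation: two sites `x, y ∈ ℤ²` are at distance `1` iff `(x₁ - y₁)² + (x₂ - y₂)² = 1`
iff `y = x ± e₁` or `y = x ± e₂` (`dist_inl_inl_eq_one_iff`); a site `x` and the centre of the
face `f` are at distance `< 1` iff `(x₁ - f₁ - ½)² + (x₂ - f₂ - ½)² < 1` iff `x` is one of the
four corners of `f` (distance `√2/2`; every other site is at distance `≥ √10/2`)
(`dist_inl_inr_lt_one_iff`).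

## References

* V. Beffara, *Is critical 2D percolation universal?*, in: In and Out of Equilibrium 2,
  Progr. Probab. 60, Birkhäuser (2008), 31–58, §5.1. [Beffara2008Universal]
-/

namespace Summit.CriticalPhenomena.CardyFormulaZ2.Theorems.CardyFlipRussoTarget

open Literature.Probability.Percolation

/-- The integer points of the unit circle: `m² + n² = 1` over `ℤ` iff `(m, n)` is one of
`(±1, 0)`, `(0, ±1)`. [folklore] -/
theorem int_sq_add_sq_eq_one_iff (m n : ℤ) :
    m ^ 2 + n ^ 2 = 1 ↔
      (m = 1 ∧ n = 0) ∨ (m = -1 ∧ n = 0) ∨ (m = 0 ∧ n = 1) ∨ (m = 0 ∧ n = -1) := by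
  constructor
  · intro h
    have hm₁ : m ≤ 1 := by nlinarith [sq_nonneg n, sq_nonneg (m - 1)]
    have hm₂ : -1 ≤ m := by nlinarith [sq_nonneg n, sq_nonneg (m + 1)]
    have hn₁ : n ≤ 1 := by nlinarith [sq_nonneg m, sq_nonneg (n - 1)]
    have hn₂ : -1 ≤ n := by nlinarith [sq_nonneg m, sq_nonneg (n + 1)]
    interval_cases m <;> interval_cases n <;> revert h <;> norm_num
  · rintro (⟨rfl, rfl⟩ | ⟨rfl, rfl⟩ | ⟨rfl, rfl⟩ | ⟨rfl, rfl⟩) <;> norm_num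

/-- For integers `u, v`: `(u - ½)² + (v - ½)² < 1` iff `u, v ∈ {0, 1}` (the value is `½` on
`{0, 1}²` and at least `5/2` elsewhere). [folklore] -/
theorem sq_sub_half_add_sq_sub_half_lt_one_iff (u v : ℤ) :
    ((u : ℝ) - 1 / 2) ^ 2 + ((v : ℝ) - 1 / 2) ^ 2 < 1 ↔ (u = 0 ∨ u = 1) ∧ (v = 0 ∨ v = 1) := by
  constructor
  · intro h
    have hu₁ : (u : ℝ) < 2 := by nlinarith [sq_nonneg ((v : ℝ) - 1 / 2), sq_nonneg ((u : ℝ) - 2)]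
    have hu₂ : (-1 : ℝ) < u := by nlinarith [sq_nonneg ((v : ℝ) - 1 / 2), sq_nonneg ((u : ℝ) + 1)]
    have hv₁ : (v : ℝ) < 2 := by nlinarith [sq_nonneg ((u : ℝ) - 1 / 2), sq_nonneg ((v : ℝ) - 2)]
    have hv₂ : (-1 : ℝ) < v := by nlinarith [sq_nonneg ((u : ℝ) - 1 / 2), sq_nonneg ((v : ℝ) + 1)]
    have hu₁' : u < 2 := by exact_mod_cast hu₁
    have hu₂' : -1 < u := by exact_mod_cast hu₂
    have hv₁' : v < 2 := by exact_mod_cast hv₁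
    have hv₂' : -1 < v := by exact_mod_cast hv₂
    constructor <;> omega
  · rintro ⟨hu, hv⟩
    rcases hu with rfl | rfl <;> rcases hv with rfl | rfl <;> norm_num

/-- **Site–site distances in `G_s`**: in the standard embedding two sites `x, y ∈ ℤ²` are at
distance exactly `1` iff they are nearest neighbours, `y = x ± e₁` or `y = x ± e₂` (since
`dist = √((x₁ - y₁)² + (x₂ - y₂)²)` and the integer solutions of `m² + n² = 1` are
`(±1, 0), (0, ±1)`). [cite: Beffara2008Universal, §5.1] -/
theorem dist_inl_inl_eq_one_iff (x y : ℤ × ℤ) :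
    dist (centredSquareEmbedding (Sum.inl x)) (centredSquareEmbedding (Sum.inl y)) = 1 ↔
      (y.1 = x.1 + 1 ∧ y.2 = x.2) ∨ (x.1 = y.1 + 1 ∧ y.2 = x.2) ∨
        (y.2 = x.2 + 1 ∧ y.1 = x.1) ∨ (x.2 = y.2 + 1 ∧ y.1 = x.1) := by
  have key : dist (centredSquareEmbedding (Sum.inl x)) (centredSquareEmbedding (Sum.inl y)) =
      √(((x.1 - y.1 : ℤ) : ℝ) ^ 2 + ((x.2 - y.2 : ℤ) : ℝ) ^ 2) := by
    rw [centredSquareEmbedding_inl, centredSquareEmbedding_inl, Complex.dist_eq_re_im]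
    congr 1
    simp
  rw [key, Real.sqrt_eq_one]
  have cast_iff : ((x.1 - y.1 : ℤ) : ℝ) ^ 2 + ((x.2 - y.2 : ℤ) : ℝ) ^ 2 = 1 ↔
      (x.1 - y.1) ^ 2 + (x.2 - y.2) ^ 2 = 1 := by
    constructor
    · intro h
      exact_mod_cast h
    · intro h
      exact_mod_cast h
  rw [cast_iff, int_sq_add_sq_eq_one_iff]
  omega

/-- **Site–centre distances in `G_s`**: in the standard embedding the site `x ∈ ℤ²` and the
centre `(f₁ + ½, f₂ + ½)` of the face `f` are at distance `< 1` iff `x` is one of the four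
corners `(f₁, f₂), (f₁ + 1, f₂), (f₁, f₂ + 1), (f₁ + 1, f₂ + 1)` of that face (corner–centre
distance `√2/2 < 1`, every other site–centre distance `≥ √10/2 > 1`).
[cite: Beffara2008Universal, §5.1] -/
theorem dist_inl_inr_lt_one_iff (x f : ℤ × ℤ) :
    dist (centredSquareEmbedding (Sum.inl x)) (centredSquareEmbedding (Sum.inr f)) < 1 ↔
      (x.1 = f.1 ∨ x.1 = f.1 + 1) ∧ (x.2 = f.2 ∨ x.2 = f.2 + 1) := by
  have key : dist (centredSquareEmbedding (Sum.inl x)) (centredSquareEmbedding (Sum.inr f)) =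
      √((((x.1 - f.1 : ℤ) : ℝ) - 1 / 2) ^ 2 + (((x.2 - f.2 : ℤ) : ℝ) - 1 / 2) ^ 2) := by
    rw [centredSquareEmbedding_inl, centredSquareEmbedding_inr, Complex.dist_eq_re_im]
    congr 1
    simp
    ring
  rw [key, Real.sqrt_lt' one_pos, one_pow, sq_sub_half_add_sq_sub_half_lt_one_iff]
  omega

/-- **The `G_s` dictionary** (stub `stub_gsDictionary` of line `Sketch` for the crux `Target`,
stmt-CriticalPhenomena-6431): the crux's METRIC description of Beffara's centred square lattice
— vertices `(ℤ × ℤ) ⊕ (ℤ × ℤ)` placed by `centredSquareEmbedding`, an edge `a — b` whenever `a`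
is a site (`a.isLeft`) and either `b` is a site at distance exactly `1` or `b` is a face centre at
distance `< 1`, symmetrised by `SimpleGraph.fromRel` — IS the tree's combinatorial
`centredSquareGraph` (`ℤ²` nearest-neighbour edges plus the four centre–corner edges of every
face, no centre–centre edges).  Proof: extensionality on the two `fromRel` adjacencies, a case
split `inl/inr` on both endpoints, and the two distance computations `dist_inl_inl_eq_one_iff`,
`dist_inl_inr_lt_one_iff`. [cite: Beffara2008Universal, §5.1] -/
theorem stub_gsDictionary :
    (SimpleGraph.fromRel (fun a b : (ℤ × ℤ) ⊕ (ℤ × ℤ) ↦ a.isLeft = true ∧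
      ((b.isLeft = true ∧ dist (centredSquareEmbedding a) (centredSquareEmbedding b) = 1) ∨
       (b.isRight = true ∧ dist (centredSquareEmbedding a) (centredSquareEmbedding b) < 1)))) =
    centredSquareGraph := by
  ext a b
  simp only [SimpleGraph.fromRel_adj, centredSquareGraph_adj_iff]
  refine and_congr_right fun _ => ?_
  rcases a with x | f <;> rcases b with y | g
  · simp only [Sum.isLeft_inl, Sum.isRight_inl, dist_inl_inl_eq_one_iff, true_and,
      Bool.false_eq_true, false_and, or_false, Sum.inl.injEq, exists_eq_left', reduceCtorEq,
      exists_false]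
    simp only [Prod.ext_iff]
    omega
  · simp [-centredSquareEmbedding_inl, -centredSquareEmbedding_inr, dist_inl_inr_lt_one_iff]
  · simp [-centredSquareEmbedding_inl, -centredSquareEmbedding_inr, dist_inl_inr_lt_one_iff]
  · simp

end Summit.CriticalPhenomena.CardyFormulaZ2.Theorems.CardyFlipRussoTarget
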